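import Mathlib
import HarnessLib
import Summits.CriticalPhenomena.CardyFormulaZ2.Theses.CardyComplexCone
import Literature.Probability.LatticeModels.CornerPermutation
import Literature.Probability.Percolation.BondPercolationSymmetry
import Literature.Probability.Percolation.BondPercolationBlockIndependence
import Summits.CriticalPhenomena.CardyFormulaZ2.Theorems.CardyComplexConeEdgeCoherenceDefs

/-!
# Stub `stub_factorisation` of line `Sketch` (composition `FixedRadiusCut`), crux `CardyComplexCone.EdgeCoherence`
(item stmt-CriticalPhenomena-11385) — helper module 1/4: local functionals and the coupled inner orbit

Helper file `--supports stmt-CriticalPhenomena-11385` of the proof of the registered stub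
`stub_factorisation : Sig.stub_factorisation` (exact first-entry factorisation of the spin-`1/3` corner
observable at a fixed lattice ball, vocabulary in `CardyComplexConeEdgeCoherenceDefs`). The proof is
spread over four modules (≤ 400 lines each): `…StubFactorisationLocal` (this file), `…Orbit`, `…Entry`,
`…StubFactorisation` (the stub itself).

Contents of this module (everything proved, no named fact):
* §1 local functionals of bond percolation `P_p = setBer(E(G), p)`: a functional reading only the pairs
  of a finite set is measurable (`measurable_of_forall_inter`, it factors through the finite type
  `S → Prop`), bounded and integrable; the **product formula** `E[F G] = E[F] E[G]` for measurable
  functionals reading disjoint sets of pairs (`integral_mul_of_disjoint`, from the tree's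
  `bondPercolation_indep_edgeSigma` and Mathlib's `IndepFun.integral_fun_mul_eq_mul_integral`); translation
  invariance of expectations on `ℤ²` (`integral_comp_shift`, from `bondPercolation_map_shift`).
* §2 lattice bookkeeping for the ball `InBall ρ`: translated corners and target edges (`cTgt_sub`,
  `nextCorner_sub`), the **coupled inner orbit** (`cornerOrbit_couple`: if every target edge touching
  `B(v,ρ)` has in `M`, after translation by `-v`, the status it has in `β`, the `M`-orbit of the
  translated corner is the translated `β`-orbit as long as either stays in the ball), the turn-sign
  transfer (`sum_turnSign_couple`) and the horizon bound `n < hitBound ρ` for an orbit staying inside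
  from an outside entry corner (`lt_hitBound_of_stay`, injectivity of `nextCorner` —
  `cornerOrbit_eq_of_add_eq` of `CornerPermutation` — and counting corners).

Sources: S. Smirnov, C. R. Acad. Sci. Paris 333 (2001) §2 (the exploration process); G. Grimmett,
*Percolation* (1999) §1.3, §1.6 (product measure, translation invariance); H. Duminil-Copin, S. Smirnov,
Clay Math. Proc. 15 (2012) §6.2 (locality of the exploration).
-/

noncomputable section

namespace Summit.CriticalPhenomena.CardyFormulaZ2.Cruxes.EdgeCoherence.FixedRadiusCut

open scoped BigOperators Topology
open Filter Set MeasureTheory ProbabilityTheory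
open Literature.Probability.LatticeModels Literature.Probability.RandomPlanarGeometry
open Literature.Probability.Percolation

/-! ## §1 Local functionals of bond percolation: measurability, integrability, independence, translation -/

section Local

variable {V X : Type*}

/-- A functional of the configuration that reads only the pairs of a finite set `S`
(`F ω = F (ω ∩ S)`) is measurable for the product σ-algebra: it factors through the finite
type `S → Prop`. -/
theorem measurable_of_forall_inter [MeasurableSpace X] {S : Set (Sym2 V)} (hS : S.Finite)
    {F : BondConfig V → X} (hF : ∀ ω, F ω = F (ω ∩ S)) : Measurable F := by
  classical
  haveI : Finite S := hS.to_subtype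
  set r : BondConfig V → (S → Prop) := fun ω s => (s : Sym2 V) ∈ ω with hr
  set b : (S → Prop) → BondConfig V := fun q => {x | ∃ h : x ∈ S, q ⟨x, h⟩} with hb
  have hbr : ∀ ω, b (r ω) = ω ∩ S := by
    intro ω
    ext x
    simp only [hb, hr, Set.mem_setOf_eq, Set.mem_inter_iff]
    exact ⟨fun ⟨h, h'⟩ => ⟨h', h⟩, fun ⟨h', h⟩ => ⟨h, h'⟩⟩
  have hfac : F = (F ∘ b) ∘ r := funext fun ω => by rw [Function.comp_apply, Function.comp_apply, hbr]; exact hF ω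
  rw [hfac]
  exact (measurable_of_finite _).comp (measurable_pi_lambda _ fun s => measurable_set_mem _)

/-- A local functional (reading a finite set of pairs) has finite range, hence is bounded. -/
theorem exists_norm_le_of_forall_inter {S : Set (Sym2 V)} (hS : S.Finite)
    {F : BondConfig V → ℂ} (hF : ∀ ω, F ω = F (ω ∩ S)) : ∃ C, ∀ ω, ‖F ω‖ ≤ C := by
  have hfin : (Set.range F).Finite := by
    refine ((hS.finite_subsets).image F).subset ?_
    rintro _ ⟨ω, rfl⟩
    exact ⟨ω ∩ S, Set.inter_subset_right, (hF ω).symm⟩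
  obtain ⟨C, hC⟩ := (hfin.image fun z => ‖z‖).bddAbove
  exact ⟨C, fun ω => hC ⟨F ω, ⟨ω, rfl⟩, rfl⟩⟩

/-- A local functional (reading a finite set of pairs) is integrable under bond percolation. -/
theorem integrable_of_forall_inter {S : Set (Sym2 V)} (hS : S.Finite)
    {F : BondConfig V → ℂ} (hF : ∀ ω, F ω = F (ω ∩ S)) (G : SimpleGraph V) (p : unitInterval) :
    Integrable F (bondPercolation G p) := by
  obtain ⟨C, hC⟩ := exists_norm_le_of_forall_inter hS hF
  exact Integrable.of_bound (measurable_of_forall_inter hS hF).aestronglyMeasurable C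
    (ae_of_all _ hC)

/-- **Product formula.** Two measurable functionals reading disjoint sets of pairs have
`E[F G] = E[F] E[G]` under bond percolation (independence of the σ-algebras of disjoint edge
sets, `bondPercolation_indep_edgeSigma`). -/
theorem integral_mul_of_disjoint [Countable V] (G : SimpleGraph V) (p : unitInterval)
    {S T : Set (Sym2 V)} (hST : Disjoint S T) {F G' : BondConfig V → ℂ} (hFm : Measurable F)
    (hGm : Measurable G') (hF : ∀ ω, F ω = F (ω ∩ S)) (hG : ∀ ω, G' ω = G' (ω ∩ T)) :
    ∫ ω, F ω * G' ω ∂(bondPercolation G p) =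
      (∫ ω, F ω ∂(bondPercolation G p)) * ∫ ω, G' ω ∂(bondPercolation G p) := by
  have hind : IndepFun F G' (bondPercolation G p) := by
    rw [IndepFun_iff_Indep]
    exact indep_of_indep_of_le_right (indep_of_indep_of_le_left
      (bondPercolation_indep_edgeSigma G p hST)
      (measurable_edgeSigma_of_forall_inter hFm S hF).comap_le)
      (measurable_edgeSigma_of_forall_inter hGm T hG).comap_le
  exact hind.integral_fun_mul_eq_mul_integral hFm.aestronglyMeasurable hGm.aestronglyMeasurable

/-- **Translation invariance of expectations** under `P_{1/2}` on `ℤ²`: `E[g(ω + w)] = E[g]`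
(`bondPercolation_map_shift`, `integral_map_equiv`; no measurability needed). -/
theorem integral_comp_shift (w : Site 2) (g : BondConfig (Site 2) → ℂ) :
    ∫ ω, g (BondConfig.relabel (sym2Equiv (Site.shift w)) ω) ∂(bondPercolation (zdGraph 2) half) =
      ∫ ω, g ω ∂(bondPercolation (zdGraph 2) half) := by
  conv_rhs => rw [← bondPercolation_map_shift w half]
  rw [integral_map_equiv]

end Local

/-! ## §2 Lattice bookkeeping: the ball, translated corners, the coupled inner orbit -/

section Lattice

/-- A point of the ball has both coordinates at most `ρ` in absolute value. -/
theorem abs_le_of_inBall {ρ : ℕ} {x : Site 2} (h : InBall ρ x) (i : Fin 2) : |x i| ≤ ρ := by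
  unfold InBall at h
  have h0 : 0 ≤ x 0 ^ 2 := sq_nonneg _
  have h1 : 0 ≤ x 1 ^ 2 := sq_nonneg _
  fin_cases i
  · exact abs_le_of_sq_le_sq' (by simpa using show x 0 ^ 2 ≤ (ρ : ℤ) ^ 2 by linarith) (by positivity) |>.elim
      (fun h h' => abs_le.2 ⟨h, h'⟩)
  · exact abs_le_of_sq_le_sq' (by simpa using show x 1 ^ 2 ≤ (ρ : ℤ) ^ 2 by linarith) (by positivity) |>.elim
      (fun h h' => abs_le.2 ⟨h, h'⟩)

/-- The centre lies in the ball. -/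
theorem inBall_zero (ρ : ℕ) : InBall ρ 0 := by
  unfold InBall; simp

/-- The target edge of a translated corner is the translated target edge. -/
theorem cTgt_sub (v : Site 2) (p : Site 2 × Fin 4) :
    cTgt (p.1 - v, p.2) = (cTgt p).map (· - v) := by
  rw [cTgt, cTgt, Sym2.map_mk]
  exact congrArg _ (sub_add_eq_add_sub _ _ _)

/-- **One coupled step.** If the translated target edge has in `M` the status the target edge has
in `β`, the successor of the translated corner in `M` is the translated successor in `β`. -/
theorem nextCorner_sub {β M : BondConfig (Site 2)} {v : Site 2} {p : Site 2 × Fin 4}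
    (h : (cTgt p).map (· - v) ∈ M ↔ cTgt p ∈ β) :
    nextCorner M (p.1 - v, p.2) = ((nextCorner β p).1 - v, (nextCorner β p).2) := by
  have hc : cTgt (p.1 - v, p.2) = (cTgt p).map (· - v) := cTgt_sub v p
  by_cases hp : cTgt p ∈ β
  · rw [nextCorner_of_mem hp, nextCorner_of_mem (by rw [hc]; exact h.2 hp)]
    exact Prod.ext (sub_add_eq_add_sub _ _ _) rfl
  · rw [nextCorner_of_not_mem hp, nextCorner_of_not_mem (by rw [hc]; exact fun h' => hp (h.1 h'))]

variable {β M : BondConfig (Site 2)} {ρ : ℕ} {v : Site 2} {q : Site 2 × Fin 4}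

/-- **The coupled inner orbit.** Suppose every target edge touching the ball `B(v,ρ)` has in `M`
(after translation by `-v`) the status it has in `β`, and the target edge of `q` touches the
ball. If either the `β`-orbit of `q` (read around `v`) or the `M`-orbit of `q - v` (read around
`0`) stays in the ball at times `1, …, n`, then the two orbits agree up to time `n + 1`. -/
theorem cornerOrbit_couple
    (hM : ∀ p : Site 2 × Fin 4, (∃ x ∈ cTgt p, InBall ρ (x - v)) → ((cTgt p).map (· - v) ∈ M ↔ cTgt p ∈ β))
    (hq : ∃ x ∈ cTgt q, InBall ρ (x - v)) (n : ℕ)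
    (hn : (∀ m, 0 < m → m ≤ n → InBall ρ ((cornerOrbit β q m).1 - v)) ∨
      (∀ m, 0 < m → m ≤ n → InBall ρ (cornerOrbit M (q.1 - v, q.2) m).1)) :
    ∀ j ≤ n + 1, cornerOrbit M (q.1 - v, q.2) j = ((cornerOrbit β q j).1 - v, (cornerOrbit β q j).2) := by
  induction n with
  | zero =>
    intro j hj
    rcases Nat.le_one_iff_eq_zero_or_eq_one.1 hj with rfl | rfl
    · rfl
    · exact nextCorner_sub (hM q hq)
  | succ n ih =>
    have ih' : ∀ j ≤ n + 1, cornerOrbit M (q.1 - v, q.2) j =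
        ((cornerOrbit β q j).1 - v, (cornerOrbit β q j).2) := by
      refine ih ?_
      rcases hn with hn | hn
      · exact Or.inl fun m hm hmn => hn m hm (by omega)
      · exact Or.inr fun m hm hmn => hn m hm (by omega)
    intro j hj
    rcases Nat.lt_or_ge j (n + 2) with hlt | hge
    · exact ih' j (by omega)
    · obtain rfl : j = n + 1 + 1 := by omega
      have hin : InBall ρ ((cornerOrbit β q (n + 1)).1 - v) := by
        rcases hn with hn | hn
        · exact hn (n + 1) (by omega) le_rfl
        · have := hn (n + 1) (by omega) le_rfl
          rwa [ih' (n + 1) le_rfl] at this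
      change nextCorner M (cornerOrbit M (q.1 - v, q.2) (n + 1)) =
        ((nextCorner β (cornerOrbit β q (n + 1))).1 - v, (nextCorner β (cornerOrbit β q (n + 1))).2)
      rw [ih' (n + 1) le_rfl]
      exact nextCorner_sub (hM _ ⟨_, Sym2.mem_mk_left _ _, hin⟩)

/-- Under the coupling, "the `β`-orbit stays in `B(v,ρ)` at times `1..n`" iff "the `M`-orbit
stays in `B(0,ρ)` at times `1..n`". -/
theorem stay_iff_couple
    (hM : ∀ p : Site 2 × Fin 4, (∃ x ∈ cTgt p, InBall ρ (x - v)) → ((cTgt p).map (· - v) ∈ M ↔ cTgt p ∈ β))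
    (hq : ∃ x ∈ cTgt q, InBall ρ (x - v)) (n : ℕ) :
    (∀ m, 0 < m → m ≤ n → InBall ρ ((cornerOrbit β q m).1 - v)) ↔
      (∀ m, 0 < m → m ≤ n → InBall ρ (cornerOrbit M (q.1 - v, q.2) m).1) := by
  constructor
  · intro h m hm hmn
    rw [cornerOrbit_couple hM hq n (Or.inl h) m (by omega)]
    exact h m hm hmn
  · intro h m hm hmn
    have := h m hm hmn
    rwa [cornerOrbit_couple hM hq n (Or.inr h) m (by omega)] at this

/-- Under the coupling and while inside, the turn signs of the two orbits agree before time `n`. -/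
theorem sum_turnSign_couple
    (hM : ∀ p : Site 2 × Fin 4, (∃ x ∈ cTgt p, InBall ρ (x - v)) → ((cTgt p).map (· - v) ∈ M ↔ cTgt p ∈ β))
    (hq : ∃ x ∈ cTgt q, InBall ρ (x - v)) (n : ℕ)
    (hn : ∀ m, 0 < m → m ≤ n → InBall ρ ((cornerOrbit β q m).1 - v)) :
    ∑ i ∈ Finset.range n, (turnSign M (cornerOrbit M (q.1 - v, q.2) i) : ℝ) =
      ∑ i ∈ Finset.range n, (turnSign β (cornerOrbit β q i) : ℝ) := by
  refine Finset.sum_congr rfl fun i hi => ?_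
  rw [Finset.mem_range] at hi
  rw [cornerOrbit_couple hM hq n (Or.inl hn) i (by omega)]
  have htouch : ∃ x ∈ cTgt (cornerOrbit β q i), InBall ρ (x - v) := by
    rcases Nat.eq_zero_or_pos i with rfl | hpos
    · exact hq
    · exact ⟨_, Sym2.mem_mk_left _ _, hn i hpos (by omega)⟩
  have key := hM _ htouch
  unfold turnSign
  rw [cTgt_sub]
  by_cases h : cTgt (cornerOrbit β q i) ∈ β
  · rw [if_pos h, if_pos (key.2 h)]
  · rw [if_neg h, if_neg (fun h' => h (key.1 h'))]

/-- **No return to the entry corner while inside.** If the `M`-orbit from `e` (entry vertex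
outside the ball) stays inside at times `1..n`, its corners at times `1..n` are pairwise distinct,
hence `n < hitBound ρ` (the ball has `(2ρ+1)²` sites, four corners each). -/
theorem lt_hitBound_of_stay {e : Site 2 × Fin 4} (he : ¬ InBall ρ e.1) {n : ℕ}
    (hn : ∀ m, 0 < m → m ≤ n → InBall ρ (cornerOrbit M e m).1) : n < hitBound ρ := by
  classical
  -- injectivity on `1..n`
  have key : ∀ i j, 1 ≤ i → j ≤ n → i < j → cornerOrbit M e i ≠ cornerOrbit M e j := by
    intro i j hi hj hlt hij
    have h0 : cornerOrbit M e 0 = cornerOrbit M e (j - i) :=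
      cornerOrbit_eq_of_add_eq e i (by rw [zero_add, Nat.sub_add_cancel hlt.le]; exact hij)
    exact he (by rw [show e = cornerOrbit M e 0 from rfl, h0]; exact hn _ (by omega) (by omega))
  have hinj : Set.InjOn (cornerOrbit M e) (Finset.Icc 1 n : Set ℕ) := by
    intro i hi j hj hij
    simp only [Finset.coe_Icc, Set.mem_Icc] at hi hj
    by_contra hne
    rcases Nat.lt_or_gt_of_ne hne with hlt | hlt
    · exact key i j hi.1 hj.2 hlt hij
    · exact key j i hj.1 hi.2 hlt hij.symm
  -- the image lies in the box corners
  set box : Finset (Site 2) := Fintype.piFinset fun _ : Fin 2 => Finset.Icc (-(ρ : ℤ)) ρ with hbox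
  have hmaps : ∀ m ∈ Finset.Icc 1 n, cornerOrbit M e m ∈ box ×ˢ (Finset.univ : Finset (Fin 4)) := by
    intro m hm
    rw [Finset.mem_Icc] at hm
    refine Finset.mem_product.2 ⟨?_, Finset.mem_univ _⟩
    rw [hbox, Fintype.mem_piFinset]
    intro i
    have := abs_le_of_inBall (hn m (by omega) hm.2) i
    rw [Finset.mem_Icc]
    exact abs_le.1 this
  have hcard := Finset.card_le_card_of_injOn _ hmaps hinj
  have hb : box.card = (2 * ρ + 1) ^ 2 := by
    rw [hbox, Fintype.card_piFinset, Finset.prod_const, Finset.card_univ, Fintype.card_fin,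
      Int.card_Icc]
    congr 1
    omega
  rw [Nat.card_Icc, Finset.card_product, Finset.card_univ, Fintype.card_fin, hb] at hcard
  unfold hitBound
  omega

end Lattice

/-! ## Registered glue sub-goal of this module -/

/-- **Glue sub-goal `integral_mul_of_local_disjoint`** (registered on stmt-CriticalPhenomena-11385 for
this helper module): the product formula for measurable local functionals of disjoint sets of pairs under
critical bond percolation on `ℤ²` — the independence input of the first-entry factorisation. -/
theorem integral_mul_of_local_disjoint : ∀ (S T : Set (Sym2 (Site 2))) (F G : BondConfig (Site 2) → ℂ), Disjoint S T → Measurable F → Measurable G → (∀ ω, F ω = F (ω ∩ S)) → (∀ ω, G ω = G (ω ∩ T)) → ∫ ω, F ω * G ω ∂(bondPercolation (zdGraph 2) half) = (∫ ω, F ω ∂(bondPercolation (zdGraph 2) half)) * ∫ ω, G ω ∂(bondPercolation (zdGraph 2) half) :=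
  fun _ _ _ _ hST hF hG hFS hGT => integral_mul_of_disjoint (zdGraph 2) half hST hF hG hFS hGT

end Summit.CriticalPhenomena.CardyFormulaZ2.Cruxes.EdgeCoherence.FixedRadiusCut

end
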